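import Summits.Ventures.DiscreteObjects.PP12.FlagOrbitTenData
import Summits.Ventures.DiscreteObjects.PP12.FlagOrbitBridgeSeven

/-!
# A plain `ρ = 2` orbit matrix carries the structured `f = 7` data: `IsFlagOrbitMatrix 2 M → IsFlagSevenOrbitMatrix (sevenDataOfPlain h)` (kernel; converse bridge)
Framing: lottery ticket; floor = certified bounds/negative ranges.

Cell pub-namedobj (venture DiscreteObjects), target (M), designs gen 15; the `f = 7` analogue of `FlagOrbitTenData` / `FlagOrbitBridgeTen`, and the converse of
`FlagOrbitBridgeSeven`. From a plain matrix `M` with `IsFlagOrbitMatrix 2 M` (p344983) extract designs g13's structured data `FlagSevenOrbitData` (p327216):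
`κ s i` (the unique `Z`-orbit of a side row, `FlagOrbitBlocks.side_Z_block`), `ψ s i` (the unique off-diagonal `1` in the own-class triangle block — block sum `3`,
diagonal `2`), `R s i` (the support in the other-class triangle block — a `0/1` segment with sum `3`), `γ`, `β` (`FlagOrbitBlocks.tpt_block`), `C k t s` (the support of
a T-line row in the class-`s` triangle block; every triangle lies in exactly one `C k t s` since the four T-rows through `y_k` are orthogonal `0/1` rows with block sums
`3`). The structured ENTRY function of the extracted data coincides with `M` (`entry_sevenDataOfPlain`), so the two inner-product systems are literally those of `M`,
and the shape conjuncts hold: **`isFlagSevenOrbitMatrix_sevenDataOfPlain`**, hence **`noFlagOrbitMatrix_two_of_noFlagSevenOrbitMatrix :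
NoFlagSevenOrbitMatrix → NoFlagOrbitMatrix 2`** — with `FlagOrbitBridgeSeven` the plain and the structured `f = 7` statements are EQUIVALENT
(`noFlagOrbitMatrix_two_iff`). Census status of both: UNDECIDED. Nothing here decides anything. No `sorry`, no new axioms.
-/

namespace Summit.Ventures.DiscreteObjects.PP12

open Finset
open scoped Classical

namespace IsFlagOrbitMatrix

/-! ### Generic: off its own triangle a side row is a `0/1` row -/

/-- **Off the diagonal a side row has entries `≤ 1`** (norm = total + 2 and the diagonal entry is `2`). -/
theorem side_offdiag_le_one {ρ : ℕ} {M : FRow ρ → FCol ρ → ℕ} (h : IsFlagOrbitMatrix ρ M) (x : Fin ρ × Fin 12) (c₀ : FCol ρ)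
    (hc : c₀ ≠ Sum.inr (Sum.inl x)) : M (Sum.inr (Sum.inl x)) c₀ ≤ 1 := by
  by_contra hlt
  push Not at hlt
  have hsq := side_row_sq_sub h x
  set r := (Sum.inr (Sum.inl x) : FRow ρ)
  have hd : M r (Sum.inr (Sum.inl x)) = 2 := h.2.2.2.2.2.2 x
  -- split both sums at the diagonal column and at c₀
  have h1 : ∑ c : FCol ρ, M r c * M r c = M r (Sum.inr (Sum.inl x)) * M r (Sum.inr (Sum.inl x)) + ∑ c ∈ univ.erase (Sum.inr (Sum.inl x)), M r c * M r c :=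
    (Finset.add_sum_erase univ (fun c => M r c * M r c) (mem_univ _)).symm
  have h2 : ∑ c : FCol ρ, M r c = M r (Sum.inr (Sum.inl x)) + ∑ c ∈ univ.erase (Sum.inr (Sum.inl x)), M r c :=
    (Finset.add_sum_erase univ (fun c => M r c) (mem_univ _)).symm
  have hc₀ : c₀ ∈ univ.erase (Sum.inr (Sum.inl x) : FCol ρ) := mem_erase.2 ⟨hc, mem_univ _⟩
  have h3 : ∑ c ∈ univ.erase (Sum.inr (Sum.inl x)), M r c * M r c = M r c₀ * M r c₀ + ∑ c ∈ (univ.erase (Sum.inr (Sum.inl x))).erase c₀, M r c * M r c :=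
    (Finset.add_sum_erase _ (fun c => M r c * M r c) hc₀).symm
  have h4 : ∑ c ∈ univ.erase (Sum.inr (Sum.inl x)), M r c = M r c₀ + ∑ c ∈ (univ.erase (Sum.inr (Sum.inl x))).erase c₀, M r c :=
    (Finset.add_sum_erase _ (fun c => M r c) hc₀).symm
  have h5 : ∑ c ∈ (univ.erase (Sum.inr (Sum.inl x))).erase c₀, M r c ≤ ∑ c ∈ (univ.erase (Sum.inr (Sum.inl x))).erase c₀, M r c * M r c :=
    Finset.sum_le_sum fun c _ => Nat.le_mul_self (M r c)
  have h6 : 2 * M r c₀ ≤ M r c₀ * M r c₀ := Nat.mul_le_mul_right _ hlt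
  rw [h1, h2, h3, h4, hd] at hsq
  omega

variable {M : FRow 2 → FCol 2 → ℕ}

/-- side row `(s,i)` (`ρ = 2`) -/
abbrev sd₂ (s : Fin 2) (i : Fin 12) : FRow 2 := Sum.inr (Sum.inl (s, i))
/-- triangle column `(s,i)` -/
abbrev tr₂ (s : Fin 2) (i : Fin 12) : FCol 2 := Sum.inr (Sum.inl (s, i))
/-- T-line row `(k,t)` -/
abbrev tl₂ (k : Fin 6) (t : Fin 4) : FRow 2 := Sum.inr (Sum.inr (k, t))
/-- T-point column `(j,t)` -/
abbrev tp₂ (j : Fin 6) (t : Fin 4) : FCol 2 := Sum.inr (Sum.inr (j, t))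

/-! ### Extraction -/

/-- `κ s i`: the `Z`-orbit of the sides of triangle `(s,i)`. -/
noncomputable def kap (h : IsFlagOrbitMatrix 2 M) (s : Fin 2) (i : Fin 12) : Fin 2 :=
  (exists_eq_one_of_sum_eq_one _ (side_Z_block h (s, i))).choose

/-- Closed form of the side/`Z` entries. -/
theorem sd_z_eq (h : IsFlagOrbitMatrix 2 M) (s : Fin 2) (i : Fin 12) (t : Fin 2) :
    M (sd₂ s i) (Sum.inl t) = if kap h s i = t then 1 else 0 := by
  have hs := (exists_eq_one_of_sum_eq_one _ (side_Z_block h (s, i))).choose_spec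
  set t₀ := (exists_eq_one_of_sum_eq_one _ (side_Z_block h (s, i))).choose
  change M (sd₂ s i) (Sum.inl t) = if t₀ = t then 1 else 0
  by_cases e : t₀ = t
  · rw [if_pos e, ← e]; exact hs.1
  · rw [if_neg e]; exact hs.2 t (fun e' => e e'.symm)

/-- The own-class off-diagonal triangle entries of a side row sum to `1`. -/
theorem sd_tr_own_offdiag_sum (h : IsFlagOrbitMatrix 2 M) (s : Fin 2) (i : Fin 12) :
    ∑ i', (if i' = i then 0 else M (sd₂ s i) (tr₂ s i')) = 1 := by
  have h3 := tri_block_sum h s (sd₂ s i) (fun s' hh => by cases hh)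
  have hd : M (sd₂ s i) (tr₂ s i) = 2 := h.2.2.2.2.2.2 (s, i)
  have hsplit := (Finset.add_sum_erase univ (fun i' => M (sd₂ s i) (tr₂ s i')) (mem_univ i)).symm
  rw [h3, hd] at hsplit
  rw [← Finset.add_sum_erase univ _ (mem_univ i), if_pos rfl, zero_add]
  rw [Finset.sum_congr rfl (fun i' hi' => if_neg (ne_of_mem_erase hi'))]
  omega

/-- `ψ s i`: the own-class triangle of the odd point — the unique `i' ≠ i` with entry `1`. -/
noncomputable def psi₂ (h : IsFlagOrbitMatrix 2 M) (s : Fin 2) (i : Fin 12) : Fin 12 :=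
  (exists_eq_one_of_sum_eq_one _ (sd_tr_own_offdiag_sum h s i)).choose

/-- Closed form of the own-class side/triangle entries. -/
theorem sd_tr_own_eq (h : IsFlagOrbitMatrix 2 M) (s : Fin 2) (i i' : Fin 12) :
    M (sd₂ s i) (tr₂ s i') = if i' = i then 2 else if i' = psi₂ h s i then 1 else 0 := by
  have hs := (exists_eq_one_of_sum_eq_one _ (sd_tr_own_offdiag_sum h s i)).choose_spec
  set i₀ := (exists_eq_one_of_sum_eq_one _ (sd_tr_own_offdiag_sum h s i)).choose
  change M (sd₂ s i) (tr₂ s i') = if i' = i then 2 else if i' = i₀ then 1 else 0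
  have hne : i₀ ≠ i := by intro e; have := hs.1; rw [if_pos e] at this; exact absurd this (by norm_num)
  by_cases e : i' = i
  · rw [if_pos e, e]; exact h.2.2.2.2.2.2 (s, i)
  · rw [if_neg e]
    by_cases e' : i' = i₀
    · rw [if_pos e', e']; have := hs.1; rwa [if_neg hne] at this
    · rw [if_neg e']; have := hs.2 i' e'; rwa [if_neg e] at this

/-- `ψ s i ≠ i`. -/
theorem psi₂_ne (h : IsFlagOrbitMatrix 2 M) (s : Fin 2) (i : Fin 12) : psi₂ h s i ≠ i := by
  intro e
  have hs := (exists_eq_one_of_sum_eq_one _ (sd_tr_own_offdiag_sum h s i)).choose_spec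
  have h1 := hs.1
  change (if psi₂ h s i = i then 0 else M (sd₂ s i) (tr₂ s (psi₂ h s i))) = 1 at h1
  rw [if_pos e] at h1
  exact absurd h1 (by norm_num)

/-- `R s i`: the triangles of the OTHER class met by the side of `(s,i)`. -/
noncomputable def arr (M : FRow 2 → FCol 2 → ℕ) (s : Fin 2) (i : Fin 12) : Finset (Fin 12) :=
  univ.filter fun i' => ∃ s', s' ≠ s ∧ M (sd₂ s i) (tr₂ s' i') = 1

/-- Closed form of the other-class side/triangle entries. -/
theorem sd_tr_other_eq (h : IsFlagOrbitMatrix 2 M) {s s' : Fin 2} (hss : s' ≠ s) (i i' : Fin 12) :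
    M (sd₂ s i) (tr₂ s' i') = if i' ∈ arr M s i then 1 else 0 := by
  have hle : M (sd₂ s i) (tr₂ s' i') ≤ 1 := side_offdiag_le_one h (s, i) _ (fun hh => hss (by cases hh; rfl))
  by_cases hm : i' ∈ arr M s i
  · rw [if_pos hm]
    obtain ⟨-, s'', hs'', h1⟩ := mem_filter.1 hm
    have e3 : s'' = s' := by omega
    rw [e3] at h1; exact h1
  · rw [if_neg hm]
    by_contra hne
    apply hm
    exact mem_filter.2 ⟨mem_univ _, s', hss, by omega⟩

/-- `|R s i| = 3` (other-class block sum `3`, `0/1` entries). -/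
theorem card_arr (h : IsFlagOrbitMatrix 2 M) (s : Fin 2) (i : Fin 12) : (arr M s i).card = 3 := by
  have hss : (1 - s) ≠ s := by fin_cases s <;> decide
  have h3 := tri_block_sum h (1 - s) (sd₂ s i) (fun s' hh => by cases hh)
  rw [Finset.sum_congr rfl (fun i' _ => sd_tr_other_eq h hss i i')] at h3
  rw [Finset.sum_boole] at h3
  simpa using h3

/-- `γ s i j`: the T-point orbit on `m_j` met by the sides of `(s,i)`. -/
noncomputable def gam₂ (h : IsFlagOrbitMatrix 2 M) (s : Fin 2) (i : Fin 12) (j : Fin 6) : Fin 4 :=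
  (exists_eq_one_of_sum_eq_one _ (tpt_block h (sd₂ s i) (fun s' hh => by cases hh) j)).choose

/-- Closed form of the side/T-point entries. -/
theorem sd_tp_eq₂ (h : IsFlagOrbitMatrix 2 M) (s : Fin 2) (i : Fin 12) (j : Fin 6) (t : Fin 4) :
    M (sd₂ s i) (tp₂ j t) = if gam₂ h s i j = t then 1 else 0 := by
  have hs := (exists_eq_one_of_sum_eq_one _ (tpt_block h (sd₂ s i) (fun s' hh => by cases hh) j)).choose_spec
  set t₀ := (exists_eq_one_of_sum_eq_one _ (tpt_block h (sd₂ s i) (fun s' hh => by cases hh) j)).choose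
  change M (sd₂ s i) (tp₂ j t) = if t₀ = t then 1 else 0
  by_cases e : t₀ = t
  · rw [if_pos e, ← e]; exact hs.1
  · rw [if_neg e]; exact hs.2 t (fun e' => e e'.symm)

/-- `β k t j`: the T-point orbit on `m_j` met by the T-line orbit `(k,t)`. -/
noncomputable def bet₂ (h : IsFlagOrbitMatrix 2 M) (k : Fin 6) (t : Fin 4) (j : Fin 6) : Fin 4 :=
  (exists_eq_one_of_sum_eq_one _ (tpt_block h (tl₂ k t) (fun s' hh => by cases hh) j)).choose

/-- Closed form of the T-line/T-point entries. -/
theorem tl_tp_eq₂ (h : IsFlagOrbitMatrix 2 M) (k : Fin 6) (t : Fin 4) (j : Fin 6) (t' : Fin 4) :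
    M (tl₂ k t) (tp₂ j t') = if bet₂ h k t j = t' then 1 else 0 := by
  have hs := (exists_eq_one_of_sum_eq_one _ (tpt_block h (tl₂ k t) (fun s' hh => by cases hh) j)).choose_spec
  set t₀ := (exists_eq_one_of_sum_eq_one _ (tpt_block h (tl₂ k t) (fun s' hh => by cases hh) j)).choose
  change M (tl₂ k t) (tp₂ j t') = if t₀ = t' then 1 else 0
  by_cases e : t₀ = t'
  · rw [if_pos e, ← e]; exact hs.1
  · rw [if_neg e]; exact hs.2 t' (fun e' => e e'.symm)

/-- `C k t s`: the triangles of class `s` whose vertices lie on the T-line orbit `(k,t)`. -/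
noncomputable def cee₂ (M : FRow 2 → FCol 2 → ℕ) (k : Fin 6) (t : Fin 4) (s : Fin 2) : Finset (Fin 12) :=
  univ.filter fun i => M (tl₂ k t) (tr₂ s i) = 1

/-- Closed form of the T-line/triangle entries. -/
theorem tl_tr_eq₂ (h : IsFlagOrbitMatrix 2 M) (k : Fin 6) (t : Fin 4) (s : Fin 2) (i : Fin 12) :
    M (tl₂ k t) (tr₂ s i) = if i ∈ cee₂ M k t s then 1 else 0 := by
  have hle : M (tl₂ k t) (tr₂ s i) ≤ 1 := entry_le_one_of_not_side h _ (fun x hh => by cases hh) _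
  by_cases hm : i ∈ cee₂ M k t s
  · rw [if_pos hm]; exact (mem_filter.1 hm).2
  · rw [if_neg hm]
    by_contra hne
    exact hm (mem_filter.2 ⟨mem_univ _, by omega⟩)

/-- `|C k t s| = 3` (block sum of a `0/1` row). -/
theorem card_cee₂ (h : IsFlagOrbitMatrix 2 M) (k : Fin 6) (t : Fin 4) (s : Fin 2) : (cee₂ M k t s).card = 3 := by
  have h3 := tri_block_sum h s (tl₂ k t) (fun s' hh => by cases hh)
  rw [Finset.sum_congr rfl (fun i _ => tl_tr_eq₂ h k t s i), Finset.sum_boole] at h3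
  simpa using h3

/-- Every triangle lies in exactly one `C k t s` (for fixed `k, s`): `Σ_t M (k,t) (s,i) = 1`. -/
theorem tl_tr_sum₂ (h : IsFlagOrbitMatrix 2 M) (k : Fin 6) (s : Fin 2) (i : Fin 12) : ∑ t : Fin 4, M (tl₂ k t) (tr₂ s i) = 1 := by
  have hle : ∀ i' : Fin 12, ∑ t : Fin 4, M (tl₂ k t) (tr₂ s i') ≤ 1 := by
    intro i'
    refine block_sum_le_one _ (fun t => entry_le_one_of_not_side h _ (fun x hh => by cases hh) _) fun t t' htt => ?_
    exact entry_mul_eq_zero_of_rows h (by simp [FlagOrbit.rowTarget, htt]) _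
  have htot : ∑ i' : Fin 12, ∑ t : Fin 4, M (tl₂ k t) (tr₂ s i') = Fintype.card (Fin 12) := by
    rw [Finset.sum_comm]
    have : ∀ t : Fin 4, ∑ i' : Fin 12, M (tl₂ k t) (tr₂ s i') = 3 := fun t => tri_block_sum h s (tl₂ k t) (fun s' hh => by cases hh)
    rw [Finset.sum_congr rfl (fun t _ => this t)]
    simp
  exact eq_one_of_sum_eq_card _ hle htot i

/-- `#{t : i ∈ C k t s} = 1`. -/
theorem card_cee₂_through (h : IsFlagOrbitMatrix 2 M) (k : Fin 6) (s : Fin 2) (i : Fin 12) :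
    (univ.filter fun t : Fin 4 => i ∈ cee₂ M k t s).card = 1 := by
  have h1 := tl_tr_sum₂ h k s i
  rw [Finset.sum_congr rfl (fun t _ => tl_tr_eq₂ h k t s i), Finset.sum_boole] at h1
  simpa using h1

/-- `β k · j` is injective (T-rows through the same `y_k` are orthogonal), hence bijective. -/
theorem bet₂_bijective (h : IsFlagOrbitMatrix 2 M) (k j : Fin 6) : Function.Bijective fun t => bet₂ h k t j := by
  refine Finite.injective_iff_bijective.1 fun t t' htt => ?_
  by_contra hne
  have h0 := entry_mul_eq_zero_of_rows h (r₁ := tl₂ k t) (r₂ := tl₂ k t') (by simp [FlagOrbit.rowTarget, hne]) (tp₂ j (bet₂ h k t j))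
  have htt' : bet₂ h k t j = bet₂ h k t' j := htt
  rw [tl_tp_eq₂ h k t j, tl_tp_eq₂ h k t' j, if_pos rfl, ← htt', if_pos rfl] at h0
  exact absurd h0 (by norm_num)

/-- **The structured `f = 7` data of a plain `ρ = 2` orbit matrix.** -/
noncomputable def sevenDataOfPlain (h : IsFlagOrbitMatrix 2 M) : FlagSevenOrbitData :=
  { κ := kap h, ψ := psi₂ h, R := arr M, γ := gam₂ h, C := cee₂ M, β := fun k t j => bet₂ h k t j }

/-- `ind p` evaluated. -/
theorem ind_of_pos {p : Prop} (hp : p) : FlagSevenOrbitData.ind p = 1 := by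
  unfold FlagSevenOrbitData.ind; exact if_pos hp
/-- `ind p` evaluated. -/
theorem ind_of_neg {p : Prop} (hp : ¬ p) : FlagSevenOrbitData.ind p = 0 := by
  unfold FlagSevenOrbitData.ind; exact if_neg hp

/-- `if p then 1 else 0 = ind p` for any decidability instance. -/
theorem ite_eq_ind (p : Prop) [Decidable p] : (if p then 1 else 0 : ℕ) = FlagSevenOrbitData.ind p := by
  by_cases hp : p
  · rw [if_pos hp, ind_of_pos hp]
  · rw [if_neg hp, ind_of_neg hp]

/-- **The structured entry function of the extracted data IS the plain matrix.** -/
theorem entry_sevenDataOfPlain (h : IsFlagOrbitMatrix 2 M) (r : FRow 2) (c : FCol 2) : (sevenDataOfPlain h).entry r c = M r c := by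
  rcases r with s | ⟨s, i⟩ | ⟨k, t⟩ <;> rcases c with t' | ⟨s', i'⟩ | ⟨j, t'⟩
  · -- Γ / Z
    show (0 : ℕ) = M (Sum.inl s) (Sum.inl t')
    rw [h.2.2.2.2.1 s (Sum.inl t')]; rfl
  · -- Γ / tri
    show FlagSevenOrbitData.ind (s' = s) = M (Sum.inl s) (Sum.inr (Sum.inl (s', i')))
    rw [h.2.2.2.2.1 s, ← ite_eq_ind]; rfl
  · show (0 : ℕ) = M (Sum.inl s) (Sum.inr (Sum.inr (j, t')))
    rw [h.2.2.2.2.1 s (Sum.inr (Sum.inr (j, t')))]; rfl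
  · -- side / Z
    show FlagSevenOrbitData.ind (kap h s i = t') = M (sd₂ s i) (Sum.inl t')
    rw [sd_z_eq h s i t', ite_eq_ind]
  · -- side / tri
    show (if s' = s then 2 * FlagSevenOrbitData.ind (i' = i) + FlagSevenOrbitData.ind (i' = psi₂ h s i) else FlagSevenOrbitData.ind (i' ∈ arr M s i))
        = M (sd₂ s i) (tr₂ s' i')
    by_cases hss : s' = s
    · subst hss
      rw [if_pos rfl, sd_tr_own_eq h s' i i']
      by_cases e : i' = i
      · rw [if_pos e, ind_of_pos e, ind_of_neg (fun e' => psi₂_ne h s' i (e'.symm.trans e))]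
      · rw [if_neg e, ind_of_neg e, mul_zero, zero_add, ite_eq_ind]
    · rw [if_neg hss, sd_tr_other_eq h hss i i', ite_eq_ind]
  · -- side / tpt
    show FlagSevenOrbitData.ind (gam₂ h s i j = t') = M (sd₂ s i) (tp₂ j t')
    rw [sd_tp_eq₂ h s i j t', ite_eq_ind]
  · -- T / Z
    show (0 : ℕ) = M (Sum.inr (Sum.inr (k, t))) (Sum.inl t')
    exact (h.2.2.2.2.2.1 (k, t) t').symm
  · -- T / tri
    show FlagSevenOrbitData.ind (i' ∈ cee₂ M k t s') = M (tl₂ k t) (tr₂ s' i')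
    rw [tl_tr_eq₂ h k t s' i', ite_eq_ind]
  · -- T / tpt
    show FlagSevenOrbitData.ind (bet₂ h k t j = t') = M (tl₂ k t) (tp₂ j t')
    rw [tl_tp_eq₂ h k t j t', ite_eq_ind]

/-- **A plain `ρ = 2` orbit matrix yields structured `f = 7` data satisfying `IsFlagSevenOrbitMatrix`.** -/
theorem isFlagSevenOrbitMatrix_sevenDataOfPlain (h : IsFlagOrbitMatrix 2 M) : IsFlagSevenOrbitMatrix (sevenDataOfPlain h) := by
  have hent : (sevenDataOfPlain h).entry = M := funext fun r => funext fun c => entry_sevenDataOfPlain h r c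
  refine ⟨fun s i => psi₂_ne h s i, fun s i => card_arr h s i, fun k t s => card_cee₂ h k t s, fun k s i => card_cee₂_through h k s i,
    fun k j => bet₂_bijective h k j, fun r r' => ?_, fun c c' => ?_⟩
  · rw [hent, FlagSevenOrbitData.rowTarget_eq]; exact h.2.2.1 r r'
  · rw [hent, FlagSevenOrbitData.colTarget_eq]; exact h.2.2.2.1 c c'

end IsFlagOrbitMatrix

/-- **The structured `f = 7` statement implies the plain one:** `NoFlagSevenOrbitMatrix → NoFlagOrbitMatrix 2`. -/
theorem noFlagOrbitMatrix_two_of_noFlagSevenOrbitMatrix (h7 : NoFlagSevenOrbitMatrix) : NoFlagOrbitMatrix 2 :=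
  fun _ hM => h7 _ (IsFlagOrbitMatrix.isFlagSevenOrbitMatrix_sevenDataOfPlain hM)

/-- **The plain and the structured `f = 7` orbit-level statements are equivalent.** -/
theorem noFlagOrbitMatrix_two_iff : NoFlagOrbitMatrix 2 ↔ NoFlagSevenOrbitMatrix :=
  ⟨noFlagSevenOrbitMatrix_of_noFlagOrbitMatrix_two, noFlagOrbitMatrix_two_of_noFlagSevenOrbitMatrix⟩

end Summit.Ventures.DiscreteObjects.PP12
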